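import Summits.Ventures.Crystal3D.Theorems.StickyWulffConstantPolycrystalWulffBoundArrangementCells

/-!
# `PolycrystalWulffBound`: disjoint refinement of a polyhedral set, in `PolytopeCalculus` (B)'s format

Route `StickyWulffConstant` of the venture `Summits/Ventures/Crystal3D`, crux `PolycrystalWulffBound`
(item `stmt-Ventures-19482`), second prover lane; companion of
`StickyWulffConstantPolycrystalWulffBoundArrangementCells.lean` (the cells of the arrangement of a
finite constraint set `𝓗`: membership, disjointness, common planes, good cells exhaust the polyhedral
set a.e., clause (A)'s hypotheses on nonempty cells).  This file REPACKAGES the nonempty good cells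
in the `Fin k` format of clause (B) of `PolytopeCalculus` (line TexShadow on `stmt-Ventures-19483`),
so that a finite union of (possibly overlapping) open H-polyhedra — the P stub's `Poly` grains — can
be fed to the facet calculus:

* `exists_mem_not_mem_of_ne` — two distinct sub-Finsets are distinguished by an ambient element;
* `exists_disjoint_polytope_refinement` — for `𝓗` with unit normals and a family `𝒢` of sub-Finsets
  with bounded polytopes: finitely many open H-polytopes `⋂_{q ∈ H j} {⟪q.1, x⟫ < q.2}` which are
  bounded, have unit normals and pairwise distinct facet planes, are pairwise disjoint with closures
  meeting inside a plane `{⟪ν j j', x⟫ = b}` (`‖ν j j'‖ = 1`), lie inside `⋃_{G ∈ 𝒢} polytope G`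
  and exhaust it up to a null set.
WHAT THIS IS NOT: the facet calculus itself; nothing on the crux beyond bookkeeping.
-/

noncomputable section

namespace Summit.Ventures.Crystal3D.Theorems

open MeasureTheory Set
open scoped RealInnerProductSpace Classical

variable {E : Type*} [NormedAddCommGroup E] [InnerProductSpace ℝ E] [FiniteDimensional ℝ E]
  [MeasurableSpace E] [BorelSpace E]

/-! ### Repackaging in the format of clause (B) of `PolytopeCalculus` -/

/-- Two distinct sub-Finsets are distinguished by some element of the ambient Finset. -/
theorem exists_mem_not_mem_of_ne {α : Type*} {𝓗 T T' : Finset α} (hT : T ⊆ 𝓗) (hT' : T' ⊆ 𝓗)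
    (hne : T ≠ T') : ∃ p ∈ 𝓗, (p ∈ T ∧ p ∉ T') ∨ (p ∈ T' ∧ p ∉ T) := by
  by_cases h : T ⊆ T'
  · have h' : ¬ T' ⊆ T := fun h' => hne (Finset.Subset.antisymm h h')
    obtain ⟨p, hp, hpn⟩ := Finset.not_subset.1 h'
    exact ⟨p, hT' hp, Or.inr ⟨hp, hpn⟩⟩
  · obtain ⟨p, hp, hpn⟩ := Finset.not_subset.1 h
    exact ⟨p, hT hp, Or.inl ⟨hp, hpn⟩⟩

/-- **Disjoint refinement of a finite union of open H-polyhedra, in clause (B)'s format.** Let `𝓗` be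
a finite constraint set with UNIT normals and `𝒢` a finite family of sub-Finsets of `𝓗` whose open
polytopes are bounded. Then there are finitely many open H-polytopes `Q_j = ⋂_{q ∈ H j} {⟪q.1, x⟫ < q.2}`
(the nonempty good cells of the arrangement) which are bounded, have unit normals and pairwise
distinct facet planes (clause (A)'s hypotheses), are pairwise disjoint with closures meeting inside a
plane `{⟪ν j j', x⟫ = b}` with `‖ν j j'‖ = 1` (clause (B)'s hypotheses), lie inside the polyhedral set
`⋃_{G ∈ 𝒢} polytope G`, and exhaust it up to a null set. -/
theorem exists_disjoint_polytope_refinement (𝓗 : Finset (E × ℝ)) (h1 : ∀ p ∈ 𝓗, ‖p.1‖ = 1)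
    (𝒢 : Finset (Finset (E × ℝ))) (h𝒢 : ∀ G ∈ 𝒢, G ⊆ 𝓗)
    (hb : ∀ G ∈ 𝒢, Bornology.IsBounded (⋂ p ∈ G, {x : E | ⟪p.1, x⟫ < p.2})) :
    ∃ (k : ℕ) (H : Fin k → Finset (E × ℝ)) (ν : Fin k → Fin k → E),
      (∀ j, Bornology.IsBounded (⋂ q ∈ H j, {x : E | ⟪q.1, x⟫ < q.2})) ∧
      (∀ j, ∀ q ∈ H j, ‖q.1‖ = 1) ∧
      (∀ j, ∀ q ∈ H j, ∀ q' ∈ H j, q ≠ q' →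
        {x : E | ⟪q.1, x⟫ = q.2} ≠ {x : E | ⟪q'.1, x⟫ = q'.2}) ∧
      (∀ j j', j ≠ j' → Disjoint (⋂ q ∈ H j, {x : E | ⟪q.1, x⟫ < q.2})
        (⋂ q ∈ H j', {x : E | ⟪q.1, x⟫ < q.2})) ∧
      (∀ j j', j ≠ j' → ‖ν j j'‖ = 1 ∧ ∃ b : ℝ,
        closure (⋂ q ∈ H j, {x : E | ⟪q.1, x⟫ < q.2}) ∩
          closure (⋂ q ∈ H j', {x : E | ⟪q.1, x⟫ < q.2}) ⊆ {x : E | ⟪ν j j', x⟫ = b}) ∧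
      (∀ j, (⋂ q ∈ H j, {x : E | ⟪q.1, x⟫ < q.2}) ⊆ ⋃ G ∈ 𝒢, ⋂ p ∈ G, {x : E | ⟪p.1, x⟫ < p.2}) ∧
      ((⋃ G ∈ 𝒢, ⋂ p ∈ G, {x : E | ⟪p.1, x⟫ < p.2}) =ᵐ[volume]
        ⋃ j, ⋂ q ∈ H j, {x : E | ⟪q.1, x⟫ < q.2}) := by
  -- the signed constraint Finset and the cell of a positive part `T`
  set sgn : Finset (E × ℝ) → Finset (E × ℝ) :=
    fun T => 𝓗.image (fun p : E × ℝ => if p ∈ T then p else (-p.1, -p.2)) with hsgn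
  set cell : Finset (E × ℝ) → Set E := fun T => ⋂ q ∈ sgn T, {x : E | ⟪q.1, x⟫ < q.2} with hcell
  -- the nonempty good cells
  set goodAll : Finset (Finset (E × ℝ)) := 𝓗.powerset.filter (fun T => ∃ G ∈ 𝒢, G ⊆ T)
    with hgoodAll
  set good : Finset (Finset (E × ℝ)) := goodAll.filter (fun T => (cell T).Nonempty) with hgood
  have hgood_sub : ∀ T ∈ good, T ⊆ 𝓗 := fun T hT =>
    Finset.mem_powerset.1 (Finset.mem_filter.1 (Finset.mem_filter.1 hT).1).1
  have hgood_G : ∀ T ∈ good, ∃ G ∈ 𝒢, G ⊆ T := fun T hT =>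
    (Finset.mem_filter.1 (Finset.mem_filter.1 hT).1).2
  have hgood_ne : ∀ T ∈ good, (cell T).Nonempty := fun T hT => (Finset.mem_filter.1 hT).2
  -- enumeration
  set k : ℕ := good.card with hk
  set e : {T // T ∈ good} ≃ Fin k := good.equivFin with he
  set Tof : Fin k → Finset (E × ℝ) := fun j => (e.symm j).1 with hTof
  have hTof_mem : ∀ j, Tof j ∈ good := fun j => (e.symm j).2
  have hTof_inj : ∀ j j', j ≠ j' → Tof j ≠ Tof j' := by
    intro j j' hjj' h
    apply hjj'
    have : e.symm j = e.symm j' := Subtype.ext h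
    simpa using congrArg e this
  -- separating constraint for two distinct cells
  have hsep : ∀ j j', j ≠ j' → ∃ p ∈ 𝓗, (p ∈ Tof j ∧ p ∉ Tof j') ∨ (p ∈ Tof j' ∧ p ∉ Tof j) :=
    fun j j' hjj' => exists_mem_not_mem_of_ne (hgood_sub _ (hTof_mem j)) (hgood_sub _ (hTof_mem j'))
      (hTof_inj j j' hjj')
  -- the normals
  set ν : Fin k → Fin k → E := fun j j' =>
    if h : j ≠ j' then (Classical.choose (hsep j j' h)).1 else 0 with hν
  refine ⟨k, fun j => sgn (Tof j), ν, ?_, ?_, ?_, ?_, ?_, ?_, ?_⟩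
  · -- bounded
    intro j
    obtain ⟨G, hG, hGT⟩ := hgood_G _ (hTof_mem j)
    exact isBounded_arrCell_of_subset 𝓗 (Tof j) (h𝒢 G hG) hGT (hb G hG)
  · -- unit normals
    intro j q hq
    exact norm_fst_eq_one_of_mem_signed 𝓗 (Tof j) h1 hq
  · -- distinct planes
    intro j q hq q' hq' hqq'
    exact setOf_inner_eq_ne_of_arrCell_nonempty 𝓗 (Tof j) h1 (hgood_ne _ (hTof_mem j)) hq hq' hqq'
  · -- disjoint
    intro j j' hjj'
    obtain ⟨p, hp, h⟩ := hsep j j' hjj'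
    rcases h with ⟨hpT, hpT'⟩ | ⟨hpT', hpT⟩
    · exact disjoint_arrCell 𝓗 (Tof j) (Tof j') hp hpT hpT'
    · exact (disjoint_arrCell 𝓗 (Tof j') (Tof j) hp hpT' hpT).symm
  · -- common plane
    intro j j' hjj'
    have hspec := Classical.choose_spec (hsep j j' hjj')
    set p := Classical.choose (hsep j j' hjj') with hpdef
    have hνp : ν j j' = p.1 := by
      show (if h : j ≠ j' then (Classical.choose (hsep j j' h)).1 else 0) = p.1
      rw [dif_pos hjj']
    refine ⟨by rw [hνp]; exact h1 p hspec.1, p.2, ?_⟩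
    rw [hνp]
    rcases hspec.2 with ⟨hpT, hpT'⟩ | ⟨hpT', hpT⟩
    · exact closure_arrCell_inter_subset_plane 𝓗 (Tof j) (Tof j') hspec.1 hpT hpT'
    · rw [Set.inter_comm]
      exact closure_arrCell_inter_subset_plane 𝓗 (Tof j') (Tof j) hspec.1 hpT' hpT
  · -- inside the polyhedral set
    intro j
    obtain ⟨G, hG, hGT⟩ := hgood_G _ (hTof_mem j)
    exact (arrCell_subset_polytope 𝓗 (Tof j) (h𝒢 G hG) hGT).trans
      (subset_iUnion₂ (s := fun G (_ : G ∈ 𝒢) => ⋂ p ∈ G, {x : E | ⟪p.1, x⟫ < p.2}) G hG)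
  · -- a.e. equality: the good cells exhaust the set, empty cells are irrelevant
    have hn : ∀ p ∈ 𝓗, p.1 ≠ 0 := fun p hp h0 => by
      have := h1 p hp; rw [h0, norm_zero] at this; exact zero_ne_one this
    have hae := iUnion_polytope_ae_eq_iUnion_arrCell 𝓗 hn 𝒢 h𝒢
    refine hae.trans (ae_eq_set.2 ⟨?_, ?_⟩ : _)
    · -- goodAll-union \ enumerated union is EMPTY
      rw [Set.sdiff_eq_empty.2 ?_, measure_empty]
      intro x hx
      rw [mem_iUnion₂] at hx
      obtain ⟨T, hT, hxT⟩ := hx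
      have hTgood : T ∈ good := Finset.mem_filter.2 ⟨hT, ⟨x, hxT⟩⟩
      refine mem_iUnion.2 ⟨e ⟨T, hTgood⟩, ?_⟩
      have : Tof (e ⟨T, hTgood⟩) = T := by
        rw [hTof]; simp
      show x ∈ cell (Tof (e ⟨T, hTgood⟩))
      rw [this]; exact hxT
    · rw [Set.sdiff_eq_empty.2 ?_, measure_empty]
      intro x hx
      rw [mem_iUnion] at hx
      obtain ⟨j, hxj⟩ := hx
      exact mem_iUnion₂.2 ⟨Tof j, (Finset.mem_filter.1 (hTof_mem j)).1, hxj⟩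

end Summit.Ventures.Crystal3D.Theorems

end
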